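import Summits.Ventures.Crystal3D.Theorems.StickyWulffConstantNoReconstructionGainExactLevelDeep
import Summits.Ventures.Crystal3D.Theorems.StickyWulffConstantNoReconstructionGainExactResidualDefs
import Summits.Ventures.Crystal3D.Theorems.StickyWulffConstantNoReconstructionGainExactReplication
import Summits.Ventures.Crystal3D.Theorems.StickyWulffConstantNoReconstructionGainExactPeel
import Summits.Ventures.Crystal3D.Theorems.StickyWulffConstantNoReconstructionGainExactCertificate
import Summits.Ventures.Crystal3D.Theorems.StickyWulffConstantNoReconstructionGainOfCertificate
import HarnessLib

/-!
# The assembly of the line `replication-exactness` (v5): EXACT₀ + the wrapped residual ⟹ the crux;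
# the crux ⟺ EXACT₀ ⟺ NoCriminal ⟺ OrientationCertificate modulo the residual

HONEST FRAMING. Part of the venture `Summits/Ventures/Crystal3D` (cell `crystal3d-full`), supports the
crux `NoReconstructionGain` (stmt-Ventures-19144, route `route-Ventures-StickyWulffConstant`), line
`replication-exactness` (lead wulff-p1 g17).  The sorry-free COMPOSITION of the registered skeleton v5, as
tree theorems (so that other seats can cite the reduction):

* `coreAdhesion_of_exactZeroGain_of_residual` — EXACT₀ + `ManyWrappedCoreAdhesion` ⟹ the adhesion atom
  on cores (few wrapped off-lattice balls: the deep-band level bound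
  `deficit_ge_of_exactZeroGain_sub_offLattice_deep`; many: the residual);
* `manyWrappedCoreAdhesion_of_confinement` — the structural `CoreWrappedConfinement` implies the residual;
* `noReconstructionGain_of_exactZeroGain_of_residual`, `noReconstructionGain_of_noCriminal_of_residual`
  — **the crux from EXACT₀ (resp. from `NoCriminal`) and the residual**, via the tree's `adhesion_of_core`
  and `noReconstructionGain_of_adhesion`;
* `noReconstructionGain_iff_exactZeroGain_of_residual`, `noReconstructionGain_iff_noCriminal_of_residual`,
  `noReconstructionGain_iff_orientationCertificate_of_residual` — given the residual, the crux is
  EQUIVALENT to exact zero gain, to the non-existence of a criminal, and to the existence of an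
  orientation certificate for every film (`→` directions are the unconditional `stub_replication`,
  `noCriminal_of_noReconstructionGain`).

WHAT THIS IS NOT: EXACT₀ (`stub_noCriminal`) and the residual (`stub_manyWrappedCoreAdhesion`) are OPEN;
these are conditional assemblies; rung F-C1 not moved.
-/

noncomputable section

namespace Summit.Ventures.Crystal3D.Theorems

open Summit.Ventures.Crystal3D
open Literature.MathematicalPhysics.StatisticalMechanics (fccStacking contactDeficiency orderedContacts)
open scoped InnerProductSpace
open Finset

/-- **EXACT₀ + the residual ⟹ the adhesion atom on cores** (v5 route): for a core with few wrapped
off-lattice balls the deep-band level bound (`deficit_ge_of_exactZeroGain_sub_offLattice_deep`, from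
EXACT₀) gives the atom with a linear remainder; for a core with many, the residual gives it.  (Stated with
the core atom — the hypothesis of the tree's `adhesion_of_core` — as conclusion.)  No `sorry`. -/
theorem coreAdhesion_of_exactZeroGain_of_residual (hE : ExactZeroGain)
    (hres : ManyWrappedCoreAdhesion) :
    ∃ R C : ℝ, 1 ≤ R ∧ ∀ ν : EuclideanSpace ℝ (Fin 3), ‖ν‖ = 1 → ∀ ρ : ℝ, R ≤ ρ →
      ∀ X P : Finset (EuclideanSpace ℝ (Fin 3)),
      (∀ p ∈ X, ∀ q ∈ X, p ≠ q → 1 ≤ dist p q) → P ⊆ X →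
      (∀ p, p ∈ P ↔ (p ∈ fccStacking 1 (Real.sqrt (2 / 3)) ∧ -(2 * R) ≤ ⟪p, ν⟫_ℝ ∧
        ⟪p, ν⟫_ℝ ≤ -R ∧ ‖p‖ ^ 2 - ⟪p, ν⟫_ℝ ^ 2 ≤ ρ ^ 2)) →
      (∀ S, S ⊆ X \ P → S.Nonempty →
        contactDeficiency S < (((((X \ S) ×ˢ S).filter fun pq => dist pq.1 pq.2 = 1).card : ℕ) : ℝ)) →
      ((((P ×ˢ (X \ P)).filter fun pq => dist pq.1 pq.2 = 1).card : ℕ) : ℝ) ≤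
        contactDeficiency (X \ P) + C * ρ := by
  classical
  obtain ⟨L, R, C, hR8, hC0, hres⟩ := hres
  obtain ⟨C₁, hC₁⟩ := deficit_ge_of_exactZeroGain_sub_offLattice_deep hE R hR8
  obtain ⟨C₂, hC₂⟩ := latticeBody_deficit_le_unif
  refine ⟨R, max C (C₁ + C₂ * (1 + R) + 12 * (max L 0 + 1)), by linarith, ?_⟩
  intro ν hν ρ hρ X P hX hPX hP hcore
  have hρ1 : 1 ≤ ρ := by linarith
  have hρ0 : 0 ≤ ρ := by linarith
  have hmaxC : C * ρ ≤ max C (C₁ + C₂ * (1 + R) + 12 * (max L 0 + 1)) * ρ :=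
    mul_le_mul_of_nonneg_right (le_max_left _ _) hρ0
  have hmaxC' : (C₁ + C₂ * (1 + R) + 12 * (max L 0 + 1)) * ρ ≤
      max C (C₁ + C₂ * (1 + R) + 12 * (max L 0 + 1)) * ρ :=
    mul_le_mul_of_nonneg_right (le_max_right _ _) hρ0
  set K : ℕ := ⌊(R - 6) / 2⌋₊ with hK
  set nS : ℕ := (X.filter fun x => x ∉ fccStacking 1 (Real.sqrt (2 / 3)) ∧ -(2 * R) + 2 < ⟪x, ν⟫_ℝ ∧
    ⟪x, ν⟫_ℝ < -R - 2).card with hnS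
  by_cases hmany : L * (K : ℝ) * ρ < nS
  · -- many wrapped off-lattice balls: the residual
    have h := hres ν hν ρ hρ X P hX hPX hP hcore hmany
    linarith
  · -- few: the level method
    push Not at hmany
    have h1 := hC₁ ν hν ρ hρ X P hX hPX hP
    have h2 := hC₂ ν hν R (by linarith) (-(2 * R)) (-R) (by ring) ρ hρ P hP
    have hsplit := contactDeficiency_sdiff_split hPX
    have hK1 : 1 ≤ K := by rw [hK]; exact (Nat.one_le_floor_iff _).2 (by linarith)
    have hKpos : (0 : ℝ) < K := by exact_mod_cast hK1
    have hdiv : ((nS / K : ℕ) : ℝ) ≤ (nS : ℝ) / K := Nat.cast_div_le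
    have hSK : (nS : ℝ) / K ≤ L * ρ := by
      rw [div_le_iff₀ hKpos]
      calc (nS : ℝ) ≤ L * (K : ℝ) * ρ := hmany
        _ = L * ρ * K := by ring
    have hmax : L * ρ ≤ max L 0 * ρ := mul_le_mul_of_nonneg_right (le_max_left L 0) hρ0
    have hm0 : 0 ≤ max L 0 := le_max_right L 0
    have hcost : (12 : ℝ) * (((nS / K : ℕ) : ℝ) + 1) ≤ 12 * (max L 0 + 1) * ρ := by nlinarith
    nlinarith [h1, h2, hsplit, hcost, hρ0, hmaxC']

/-- The structural confinement statement of v4 implies the v5 residual vacuously. -/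
theorem manyWrappedCoreAdhesion_of_confinement (h : CoreWrappedConfinement) :
    ManyWrappedCoreAdhesion := by
  obtain ⟨L, R, hR, h⟩ := h
  refine ⟨L, R, 0, hR, le_rfl, ?_⟩
  intro ν hν ρ hρ X P hX hPX hP hcore hmany
  have := h ν hν ρ hρ X P hX hPX hP hcore
  linarith

/-- **EXACT₀ + the residual ⟹ the crux.** -/
theorem noReconstructionGain_of_exactZeroGain_of_residual (hE : ExactZeroGain)
    (hres : ManyWrappedCoreAdhesion) :
    Summit.Ventures.Crystal3D.Theses.StickyWulffConstant.NoReconstructionGain :=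
  noReconstructionGain_of_adhesion (adhesion_of_core (coreAdhesion_of_exactZeroGain_of_residual hE hres))

/-- **NoCriminal + the residual ⟹ the crux.** -/
theorem noReconstructionGain_of_noCriminal_of_residual (hN : NoCriminal)
    (hres : ManyWrappedCoreAdhesion) :
    Summit.Ventures.Crystal3D.Theses.StickyWulffConstant.NoReconstructionGain :=
  noReconstructionGain_of_exactZeroGain_of_residual (stub_exactZeroGain_of_noCriminal hN) hres

/-- **EXACT₀ + CONFINEMENT ⟹ the crux.** -/
theorem noReconstructionGain_of_exactZeroGain_of_confinement (hE : ExactZeroGain)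
    (hconf : CoreWrappedConfinement) :
    Summit.Ventures.Crystal3D.Theses.StickyWulffConstant.NoReconstructionGain :=
  noReconstructionGain_of_exactZeroGain_of_residual hE (manyWrappedCoreAdhesion_of_confinement hconf)

/-- Given the residual, **the crux is equivalent to exact zero gain** … -/
theorem noReconstructionGain_iff_exactZeroGain_of_residual (hres : ManyWrappedCoreAdhesion) :
    Summit.Ventures.Crystal3D.Theses.StickyWulffConstant.NoReconstructionGain ↔ ExactZeroGain :=
  ⟨stub_replication, fun hE => noReconstructionGain_of_exactZeroGain_of_residual hE hres⟩

/-- … to the non-existence of a criminal … -/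
theorem noReconstructionGain_iff_noCriminal_of_residual (hres : ManyWrappedCoreAdhesion) :
    Summit.Ventures.Crystal3D.Theses.StickyWulffConstant.NoReconstructionGain ↔ NoCriminal :=
  ⟨noCriminal_of_noReconstructionGain, fun hN => noReconstructionGain_of_noCriminal_of_residual hN hres⟩

/-- … and to the existence of an orientation certificate for every film. -/
theorem noReconstructionGain_iff_orientationCertificate_of_residual (hres : ManyWrappedCoreAdhesion) :
    Summit.Ventures.Crystal3D.Theses.StickyWulffConstant.NoReconstructionGain ↔ OrientationCertificate :=
  (noReconstructionGain_iff_exactZeroGain_of_residual hres).trans stub_certificate_iff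

end Summit.Ventures.Crystal3D.Theorems

end
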